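import Mathlib.NumberTheory.Padics.HeightOneSpectrum
import Mathlib.LinearAlgebra.BilinearForm.DualLattice
import Literature.NumberTheory.Automorphic.QuaternionPadicIntegralTrace
import Literature.NumberTheory.Automorphic.QuaternionReducedNormBaseChange
import Literature.NumberTheory.Automorphic.QuaternionIdealLocallyPrincipal
import Literature.NumberTheory.Automorphic.QuaternionAlgebraClassification
import Literature.NumberTheory.Automorphic.QuaternionMaximalOrder
import Literature.NumberTheory.Automorphic.QuaternionAlgebraUnitsProofs
import HarnessLib

/-!
# Maximal orders at a ramified prime: `O_(p) = {x : nrd x, trd x ∈ ℤ_(p)}`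
# (Vignéras, LNM 800, Ch. II §1 Lemme 1.5 with Ch. III §5 "propriétés locales")

Topic `NumberTheory/Automorphic`; theorems only (no definition, no named fact, no instance).
Let `B` be a quaternion algebra over `ℚ` and `p` a prime at which `B` is ramified
(`¬ IsSplitAt B v_p`, `QuaternionAlgebraAdelic.lean`). Vignéras II §1: over `K = ℚ_p` the
completion `B_p` is a division algebra ("corps de quaternions"), `w = v ∘ nrd` is a valuation
(Lemme 1.4) and its valuation ring `{h : nrd h ∈ ℤ_p}` is the *unique* maximal order of `B_p`
(Lemme 1.5); Ch. III §5 (Prop. 5.1 and the "propriétés locales" (2)): being a maximal order is a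
local property, the localisation of a global maximal order at `p` being the maximal order of
`B_p` intersected with `B`. We prove the resulting description of every maximal `ℤ`-order `O`
of `B` at a ramified prime, in the localisation-inside-`B` language of the tree
(`localAt p O = ℤ_(p) O`, `LatticeLocalGlobal.lean`):

* `forall_isUnit_scalarExtension_padic_of_not_isSplitAt` — **`ℚ_p ⊗ B` is a division algebra at
  a ramified `p`** (dichotomy `IsQuaternionAlgebra.division_or_split` over `ℚ_[p]`; a splitting
  over Mathlib's `ℚ_[p]` would transport to one over `ℚ_v`, i.e. to `IsSplitAt B v`, along
  `Rat.HeightOneSpectrum.adicCompletion.padicEquiv`); hence `B` itself is a division algebra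
  (`forall_isUnit_of_padic_division`);
* `not_dvd_den_reducedTrace_of_not_dvd_den_reducedNorm` etc. — for `x ∈ B` with `nrd x ∈ ℤ_(p)`
  also `trd x ∈ ℤ_(p)`, and `{x ∈ B : nrd x, trd x ∈ ℤ_(p)}` is closed under sums and products
  (the valuation ring of `B_p`, `QuaternionPadicIntegralTrace.lean`, read on `B` through
  `nrd_{B_p}(1 ⊗ x) = nrd_B(x)`, `QuaternionReducedNormBaseChange.lean`);
* `IsMaximalZOrder.mem_localAt_iff_of_padic_division` — **main theorem**: for a maximal
  `ℤ`-order `O` and such a `p`, `x ∈ O_(p) ↔ nrd x ∈ ℤ_(p) ∧ trd x ∈ ℤ_(p)`. Proof of `⇐`: the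
  lattice `T = {y : y ∈ O_(q) for all primes q ≠ p, nrd y and trd y are p-integral}` is a
  `ℤ`-order (a ring by the previous point; finitely generated because it lies in the trace dual
  `O♯`, all its elements having integral reduced trace) containing `O`, hence `T = O` by
  maximality; and a prime-to-`p` multiple of `x` lies in `T`.
  `IsMaximalZOrder.mem_localAt_iff_of_not_isSplitAt` is the form with the hypothesis
  `¬ IsSplitAt B v_p`;
* consequences: **any two maximal orders agree at a ramified prime**
  (`IsMaximalZOrder.localAt_eq_of_not_isSplitAt`), and **an Eichler order `O₁ ∩ O₂` is maximal
  at a ramified prime**: `(O₁ ∩ O₂)_(p) = O₁,(p)` (`localAt_inf_eq_of_not_isSplitAt`).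

`p`-integrality of a rational `q` is written `¬ p ∣ q.den`, as in
`QuaternionIdealLocallyPrincipal.lean`.

## References

* M.-F. Vignéras, *Arithmétique des algèbres de quaternions*, LNM 800 (1980), Ch. II §1
  Lemme 1.4, Lemme 1.5 (p. 32); Ch. III §5 Prop. 5.1 and "propriétés locales" [VignerasLNM800].
* J. Voight, *Quaternion Algebras*, GTM 288 (2021), §13.3, Lemma 10.4.2–10.4.3 [Voight2021].
-/

noncomputable section

open scoped TensorProduct
open NumberField IsDedekindDomain

universe u

namespace Literature.NumberTheory.Automorphic

/-! ### `p`-integrality of rationals inside `ℚ_[p]` -/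

section PadicRat

variable {p : ℕ} [hp : Fact p.Prime]

/-- `|q|_p ≤ 1 ↔ p ∤ den q` for a rational `q` read in `ℚ_[p]`. [folklore] -/
theorem Padic.norm_ratCast_le_one_iff {q : ℚ} : ‖(q : ℚ_[p])‖ ≤ 1 ↔ ¬ p ∣ q.den := by
  refine ⟨fun h => ?_, fun h => Padic.norm_rat_le_one h⟩
  rw [Padic.norm_le_one_iff_val_nonneg, Padic.valuation_ratCast] at h
  exact not_dvd_den_of_padicValRat_nonneg h

/-- If `m^k · r = N` with `m` prime to `p`, `N ∈ ℤ`, then `r` is `p`-integral. [folklore] -/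
theorem not_dvd_den_of_natCast_pow_mul_eq_intCast {m : ℕ} (hm0 : m ≠ 0) (hm : m.Coprime p)
    {k : ℕ} {r : ℚ} {N : ℤ} (h : (m : ℚ) ^ k * r = N) : ¬ p ∣ r.den := by
  rcases eq_or_ne r 0 with rfl | hr
  · simp [hp.out.one_lt.ne']
  refine not_dvd_den_of_padicValRat_nonneg ?_
  have hmQ : (m : ℚ) ≠ 0 := by exact_mod_cast hm0
  have hr' : r = (N : ℚ) / (m : ℚ) ^ k := by rw [← h]; field_simp
  have hN0 : (N : ℚ) ≠ 0 := by rw [← h]; exact mul_ne_zero (pow_ne_zero _ hmQ) hr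
  rw [hr', padicValRat.div hN0 (pow_ne_zero _ hmQ), padicValRat.pow,
    padicValRat_natCast_eq_zero_of_coprime hm, mul_zero, sub_zero, padicValRat.of_int]
  exact_mod_cast Nat.zero_le _

/-- A rational that is `p`-integral for every prime `p` is an integer. [folklore] -/
theorem Rat.exists_intCast_eq_of_forall_not_dvd_den {r : ℚ} (h : ∀ p : ℕ, p.Prime → ¬ p ∣ r.den) :
    ∃ N : ℤ, (N : ℚ) = r := by
  have hden : r.den = 1 := by
    by_contra h1
    obtain ⟨q, hq, hqd⟩ := Nat.exists_prime_and_dvd h1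
    exact h q hq hqd
  exact ⟨r.num, by rw [← Rat.num_div_den r, hden]; simp⟩

end PadicRat

/-! ### Localisations of orders: norms and traces are `p`-integral -/

section OrderLocal

variable {B : Type u} [Ring B] [Algebra ℚ B] [IsQuaternionAlgebra ℚ B]
variable {p : ℕ} [hp : Fact p.Prime]

/-- Elements of `O_(p)` have `p`-integral reduced norm and reduced trace (`m x ∈ O` with
`p ∤ m`, and `nrd(m x) = m² nrd x`, `trd(m x) = m trd x` are integers). [cite: VignerasLNM800, Ch. I §4 Lemme 4.1] -/
theorem IsZOrder.not_dvd_den_of_mem_localAt {O : Submodule ℤ B} (hO : IsZOrder O) {x : B}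
    (hx : x ∈ localAt p O) :
    ¬ p ∣ (reducedNorm ℚ B x).den ∧ ¬ p ∣ (reducedTrace ℚ B x).den := by
  obtain ⟨m, hm0, hm, hmx⟩ := hx
  obtain ⟨t, n, ht, hn⟩ := hO.toIsOrder.exists_int_reducedTrace_reducedNorm hmx
  refine ⟨not_dvd_den_of_natCast_pow_mul_eq_intCast hm0 hm (k := 2) (N := n) ?_,
    not_dvd_den_of_natCast_pow_mul_eq_intCast hm0 hm (k := 1) (N := t) ?_⟩
  · rw [← hn, reducedNorm_zsmul, Int.cast_natCast]
  · rw [← ht, map_zsmul, zsmul_eq_mul, Int.cast_natCast, pow_one]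

/-- Elements of a `ℤ`-order lying in `O_(q)` for every prime `q` have integral reduced trace. [folklore] -/
theorem IsZOrder.exists_intCast_eq_reducedTrace {O : Submodule ℤ B} (hO : IsZOrder O) {x : B}
    (hx : ∀ q : ℕ, q.Prime → x ∈ localAt q O) : ∃ t : ℤ, (t : ℚ) = reducedTrace ℚ B x :=
  Rat.exists_intCast_eq_of_forall_not_dvd_den fun q hq => by
    haveI : Fact q.Prime := ⟨hq⟩
    exact (hO.not_dvd_den_of_mem_localAt (hx q hq)).2

end OrderLocal

/-! ### A ramified prime: `ℚ_p ⊗ B` is a division algebra -/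

section Division

variable (B : Type u) [Ring B] [Algebra ℚ B] [IsQuaternionAlgebra ℚ B]

set_option maxHeartbeats 800000 in
/-- **At a ramified prime `p = p_v` the base change `ℚ_p ⊗ B` is a division algebra** (Vignéras
II §1: `Ram(B) = {v : B_v` corps`}`; here: the dichotomy division/`M₂` over `ℚ_[p]`,
`IsQuaternionAlgebra.division_or_split`, where a splitting over Mathlib's `ℚ_[p]` would give one
over `ℚ_v` along `ℚ_v ≃ₐ[ℚ] ℚ_[p]`, contradicting `¬ IsSplitAt B v`). [cite: VignerasLNM800, Ch. II §1 Thm. 1.1 and Ch. III §3] -/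
theorem forall_isUnit_scalarExtension_padic_of_not_isSplitAt (v : HeightOneSpectrum (𝓞 ℚ))
    (hv : ¬ IsSplitAt B v) (p : ℕ) [Fact p.Prime]
    (hp : ((Rat.HeightOneSpectrum.primesEquiv v : Nat.Primes) : ℕ) = p) :
    ∀ X : ScalarExtension ℚ ℚ_[p] B, X ≠ 0 → IsUnit X := by
  subst hp
  haveI := isQuaternionAlgebra_scalarExtension ℚ B ℚ_[Rat.HeightOneSpectrum.primesEquiv v]
  rcases IsQuaternionAlgebra.division_or_split ℚ_[Rat.HeightOneSpectrum.primesEquiv v]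
    (ScalarExtension ℚ ℚ_[Rat.HeightOneSpectrum.primesEquiv v] B) with hdiv | hsplit
  · exact hdiv
  obtain ⟨e⟩ := hsplit
  exfalso
  apply hv
  let K := v.adicCompletion ℚ
  let i : K ≃ₐ[ℚ] ℚ_[Rat.HeightOneSpectrum.primesEquiv v] :=
    (Rat.HeightOneSpectrum.adicCompletion.padicEquiv v).toAlgEquiv
  let f₁ : K ⊗[ℚ] B ≃ₐ[ℚ] ℚ_[Rat.HeightOneSpectrum.primesEquiv v] ⊗[ℚ] B :=
    Algebra.TensorProduct.congr i AlgEquiv.refl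
  let f₂ : ℚ_[Rat.HeightOneSpectrum.primesEquiv v] ⊗[ℚ] B ≃ₐ[ℚ]
      Matrix (Fin 2) (Fin 2) ℚ_[Rat.HeightOneSpectrum.primesEquiv v] :=
    ((ScalarExtension.ofTensor ℚ _ B).trans e).restrictScalars ℚ
  let f₃ : Matrix (Fin 2) (Fin 2) ℚ_[Rat.HeightOneSpectrum.primesEquiv v] ≃ₐ[ℚ]
      Matrix (Fin 2) (Fin 2) K := i.symm.mapMatrix
  let E₀ : ScalarExtension ℚ K B ≃ₐ[ℚ] Matrix (Fin 2) (Fin 2) K :=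
    ((ScalarExtension.ofTensor ℚ K B).symm.restrictScalars ℚ).trans (f₁.trans (f₂.trans f₃))
  refine ⟨AlgEquiv.ofRingEquiv (f := E₀.toRingEquiv) fun c => ?_⟩
  change E₀ (algebraMap _ _ c) = algebraMap _ _ c
  have h0 : (ScalarExtension.ofTensor ℚ K B).symm.restrictScalars ℚ (algebraMap K _ c) =
      algebraMap K (K ⊗[ℚ] B) c := rfl
  have h1 : f₁ (algebraMap K (K ⊗[ℚ] B) c) = algebraMap _ (_ ⊗[ℚ] B) (i c) := by
    rw [Algebra.TensorProduct.algebraMap_apply, Algebra.TensorProduct.algebraMap_apply,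
      Algebra.algebraMap_self_apply, Algebra.algebraMap_self_apply]
    simp [f₁, Algebra.TensorProduct.congr_apply]
  have h2 : f₂ (algebraMap _ (_ ⊗[ℚ] B) (i c)) = algebraMap _ _ (i c) := by
    simp only [f₂, AlgEquiv.restrictScalars_apply, AlgEquiv.trans_apply]
    exact e.commutes (i c)
  have h3 : f₃ (algebraMap _ (Matrix (Fin 2) (Fin 2) _) (i c)) = algebraMap K _ c := by
    simp only [f₃, AlgEquiv.mapMatrix_apply, Matrix.algebraMap_eq_diagonal]
    rw [Matrix.diagonal_map (map_zero i.symm)]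
    congr 1
    funext j
    simp
  simp only [E₀, AlgEquiv.trans_apply]
  rw [h0, h1, h2, h3]

variable {B}

/-- If `ℚ_p ⊗ B` is a division algebra then so is `B` (`nrd_{B_p}(1 ⊗ x) = nrd_B(x) ≠ 0`). [folklore] -/
theorem forall_isUnit_of_padic_division {p : ℕ} [Fact p.Prime]
    (hdivp : ∀ X : ScalarExtension ℚ ℚ_[p] B, X ≠ 0 → IsUnit X) : ∀ x : B, x ≠ 0 → IsUnit x := by
  intro x hx
  have hX : ScalarExtension.incl ℚ ℚ_[p] B x ≠ 0 := fun h =>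
    hx (ScalarExtension.incl_injective ℚ ℚ_[p] B (by rw [h, map_zero]))
  exact (ScalarExtension.isUnit_incl_iff ℚ ℚ_[p] B x).mp (hdivp _ hX)

/-- A quaternion algebra over `ℚ` ramified at some finite place is a division algebra. [cite: VignerasLNM800, Ch. III §3] -/
theorem forall_isUnit_of_not_isSplitAt (v : HeightOneSpectrum (𝓞 ℚ)) (hv : ¬ IsSplitAt B v) :
    ∀ x : B, x ≠ 0 → IsUnit x := by
  haveI : Fact (((Rat.HeightOneSpectrum.primesEquiv v : Nat.Primes) : ℕ)).Prime :=
    ⟨(Rat.HeightOneSpectrum.primesEquiv v).2⟩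
  exact forall_isUnit_of_padic_division
    (forall_isUnit_scalarExtension_padic_of_not_isSplitAt B v hv _ rfl)

end Division

/-! ### The valuation ring of `B_p` read on `B`: `p`-integral norms and traces -/

section Integral

variable {B : Type u} [Ring B] [Algebra ℚ B] [IsQuaternionAlgebra ℚ B]
variable {p : ℕ} [hp : Fact p.Prime]

/-- `nrd_B(x)` read in `ℚ_[p]` is the reduced norm of `1 ⊗ x` in `ℚ_p ⊗ B`. [folklore] -/
theorem ratCast_reducedNorm_eq_reducedNorm_incl (x : B) :
    ((reducedNorm ℚ B x : ℚ) : ℚ_[p]) =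
      reducedNorm ℚ_[p] (ScalarExtension ℚ ℚ_[p] B) (ScalarExtension.incl ℚ ℚ_[p] B x) := by
  rw [ScalarExtension.reducedNorm_incl, eq_ratCast]

/-- `trd_B(x)` read in `ℚ_[p]` is the reduced trace of `1 ⊗ x` in `ℚ_p ⊗ B`. [folklore] -/
theorem ratCast_reducedTrace_eq_reducedTrace_incl (x : B) :
    ((reducedTrace ℚ B x : ℚ) : ℚ_[p]) =
      reducedTrace ℚ_[p] (ScalarExtension ℚ ℚ_[p] B) (ScalarExtension.incl ℚ ℚ_[p] B x) := by
  rw [ScalarExtension.reducedTrace_incl, eq_ratCast]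

variable (hdivp : ∀ X : ScalarExtension ℚ ℚ_[p] B, X ≠ 0 → IsUnit X)
include hdivp

/-- **At a ramified prime, `nrd x ∈ ℤ_(p)` forces `trd x ∈ ℤ_(p)`** (Vignéras II §1 Lemme 1.4,
pulled back from `B_p`). [cite: VignerasLNM800, Ch. II §1 Lemme 1.4] -/
theorem not_dvd_den_reducedTrace_of_not_dvd_den_reducedNorm {x : B}
    (hx : ¬ p ∣ (reducedNorm ℚ B x).den) : ¬ p ∣ (reducedTrace ℚ B x).den := by
  haveI := isQuaternionAlgebra_scalarExtension ℚ B ℚ_[p]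
  rw [← Padic.norm_ratCast_le_one_iff] at hx ⊢
  rw [ratCast_reducedNorm_eq_reducedNorm_incl] at hx
  rw [ratCast_reducedTrace_eq_reducedTrace_incl]
  exact Padic.norm_reducedTrace_le_one_of_norm_reducedNorm_le_one hdivp hx

/-- **`{x : nrd x ∈ ℤ_(p)}` is closed under addition** at a ramified prime. [cite: VignerasLNM800, Ch. II §1 Lemme 1.4] -/
theorem not_dvd_den_reducedNorm_add {x y : B} (hx : ¬ p ∣ (reducedNorm ℚ B x).den)
    (hy : ¬ p ∣ (reducedNorm ℚ B y).den) : ¬ p ∣ (reducedNorm ℚ B (x + y)).den := by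
  haveI := isQuaternionAlgebra_scalarExtension ℚ B ℚ_[p]
  rw [← Padic.norm_ratCast_le_one_iff, ratCast_reducedNorm_eq_reducedNorm_incl] at hx hy ⊢
  rw [map_add]
  exact Padic.norm_reducedNorm_add_le_one hdivp hx hy

/-- The trace form is `ℤ_(p)`-valued on `{x : nrd x ∈ ℤ_(p)}` at a ramified prime:
`trd(x y) ∈ ℤ_(p)`. [cite: VignerasLNM800, Ch. II §1 Lemme 1.4] -/
theorem not_dvd_den_reducedTrace_mul {x y : B} (hx : ¬ p ∣ (reducedNorm ℚ B x).den)
    (hy : ¬ p ∣ (reducedNorm ℚ B y).den) : ¬ p ∣ (reducedTrace ℚ B (x * y)).den := by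
  haveI := isQuaternionAlgebra_scalarExtension ℚ B ℚ_[p]
  rw [← Padic.norm_ratCast_le_one_iff, ratCast_reducedNorm_eq_reducedNorm_incl] at hx hy
  rw [← Padic.norm_ratCast_le_one_iff, ratCast_reducedTrace_eq_reducedTrace_incl, map_mul]
  exact Padic.norm_reducedTrace_mul_le_one hdivp hx hy

omit hdivp in
/-- `{x : nrd x ∈ ℤ_(p)}` is closed under multiplication (multiplicativity of `nrd`). [folklore] -/
theorem not_dvd_den_reducedNorm_mul {x y : B} (hx : ¬ p ∣ (reducedNorm ℚ B x).den)
    (hy : ¬ p ∣ (reducedNorm ℚ B y).den) : ¬ p ∣ (reducedNorm ℚ B (x * y)).den := by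
  rw [reducedNorm_mul_holds ℚ B]
  exact not_dvd_den_mul hp.out hx hy

omit hdivp in
/-- `{x : nrd x ∈ ℤ_(p)}` is closed under integer multiples. [folklore] -/
theorem not_dvd_den_reducedNorm_zsmul (c : ℤ) {x : B} (hx : ¬ p ∣ (reducedNorm ℚ B x).den) :
    ¬ p ∣ (reducedNorm ℚ B (c • x)).den := by
  rw [reducedNorm_zsmul]
  exact not_dvd_den_mul hp.out (by rw [← Int.cast_pow]; exact not_dvd_den_intCast hp.out _) hx

omit [IsQuaternionAlgebra ℚ B] hdivp in
/-- `{x : trd x ∈ ℤ_(p)}` is closed under integer multiples. [folklore] -/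
theorem not_dvd_den_reducedTrace_zsmul (c : ℤ) {x : B} (hx : ¬ p ∣ (reducedTrace ℚ B x).den) :
    ¬ p ∣ (reducedTrace ℚ B (c • x)).den := by
  rw [map_zsmul, zsmul_eq_mul]
  exact not_dvd_den_mul hp.out (not_dvd_den_intCast hp.out _) hx

end Integral

/-! ### Maximal orders at a ramified prime -/

section Maximal

variable {B : Type u} [Ring B] [Algebra ℚ B] [IsQuaternionAlgebra ℚ B]
variable {p : ℕ} [hp : Fact p.Prime]

/-- **Main theorem.** Let `O` be a maximal `ℤ`-order of a quaternion algebra `B` over `ℚ` and `p`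
a prime with `ℚ_p ⊗ B` a division algebra (i.e. `p` ramified in `B`). Then
`O_(p) = {x ∈ B : nrd x ∈ ℤ_(p), trd x ∈ ℤ_(p)}` (Vignéras II §1 Lemme 1.5: the valuation ring is
the unique maximal order of `B_p`; III §5: maximality is a local property). Proof of `⇐`: the
lattice of elements lying in `O_(q)` for all `q ≠ p` and having `p`-integral norm and trace is a
`ℤ`-order containing `O` (a ring by Lemme 1.4; inside the finitely generated trace dual `O♯`),
so equals `O`. [cite: VignerasLNM800, Ch. II §1 Lemme 1.5 and Ch. III §5 Prop. 5.1] -/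
theorem IsMaximalZOrder.mem_localAt_iff_of_padic_division {O : Submodule ℤ B}
    (hO : IsMaximalZOrder O) (hdivp : ∀ X : ScalarExtension ℚ ℚ_[p] B, X ≠ 0 → IsUnit X) (x : B) :
    x ∈ localAt p O ↔ ¬ p ∣ (reducedNorm ℚ B x).den ∧ ¬ p ∣ (reducedTrace ℚ B x).den := by
  refine ⟨hO.1.not_dvd_den_of_mem_localAt, fun ⟨hxn, hxt⟩ => ?_⟩
  have hOZ : IsZOrder O := hO.1
  have hdiv : ∀ x : B, x ≠ 0 → IsUnit x := forall_isUnit_of_padic_division hdivp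
  haveI : IsAddTorsionFree B := isAddTorsionFree_of_charZero_module ℚ B
  -- the candidate order `T`
  let T : Submodule ℤ B :=
    { carrier := {y | (∀ q : ℕ, q.Prime → q ≠ p → y ∈ localAt q O) ∧
        ¬ p ∣ (reducedNorm ℚ B y).den ∧ ¬ p ∣ (reducedTrace ℚ B y).den}
      add_mem' := fun {a b} ha hb => ⟨fun q hq hqp => add_mem (ha.1 q hq hqp) (hb.1 q hq hqp),
        not_dvd_den_reducedNorm_add hdivp ha.2.1 hb.2.1, by
          rw [map_add]; exact not_dvd_den_add hp.out ha.2.2 hb.2.2⟩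
      zero_mem' := ⟨fun q _ _ => Submodule.zero_mem _, by
        rw [reducedNorm_apply_zero]; simp [hp.out.one_lt.ne'], by
        rw [map_zero]; simp [hp.out.one_lt.ne']⟩
      smul_mem' := fun c {y} hy => ⟨fun q hq hqp => Submodule.smul_mem _ c (hy.1 q hq hqp),
        not_dvd_den_reducedNorm_zsmul c hy.2.1, not_dvd_den_reducedTrace_zsmul c hy.2.2⟩ }
  have hTmem : ∀ {y : B}, y ∈ T ↔ (∀ q : ℕ, q.Prime → q ≠ p → y ∈ localAt q O) ∧
      ¬ p ∣ (reducedNorm ℚ B y).den ∧ ¬ p ∣ (reducedTrace ℚ B y).den := Iff.rfl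
  -- `O ⊆ T`
  have hOT : O ≤ T := fun y hy => hTmem.mpr ⟨fun q _ _ => le_localAt q O hy,
    hOZ.not_dvd_den_of_mem_localAt (le_localAt p O hy)⟩
  -- `T` is a ring
  have hT1 : (1 : B) ∈ T := hOT hOZ.one_mem
  have hTmul : ∀ a ∈ T, ∀ b ∈ T, a * b ∈ T := fun a ha b hb =>
    hTmem.mpr ⟨fun q hq hqp => mul_mem_localAt hOZ.mul_mem q (ha.1 q hq hqp) (hb.1 q hq hqp),
      not_dvd_den_reducedNorm_mul ha.2.1 hb.2.1, not_dvd_den_reducedTrace_mul hdivp ha.2.1 hb.2.1⟩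
  -- elements of `T` have integral reduced trace, so `T ⊆ O♯`
  have hTtr : ∀ y ∈ T, ∃ t : ℤ, (t : ℚ) = reducedTrace ℚ B y := fun y hy =>
    Rat.exists_intCast_eq_of_forall_not_dvd_den fun q hq => by
      by_cases hqp : q = p
      · subst hqp; exact hy.2.2
      · haveI : Fact q.Prime := ⟨hq⟩
        exact (hOZ.not_dvd_den_of_mem_localAt (hy.1 q hq hqp)).2
  have hTdual : T ≤ LinearMap.BilinForm.dualSubmodule
      ((LinearMap.mul ℚ B).compr₂ (reducedTrace ℚ B)) O := fun y hy => by
    rw [LinearMap.BilinForm.mem_dualSubmodule]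
    intro e he
    obtain ⟨t, ht⟩ := hTtr _ (hTmul y hy e (hOT he))
    rw [mul_compr₂_reducedTrace_apply, ← ht]
    exact Submodule.mem_one.mpr ⟨t, by simp⟩
  -- hence `T` is a `ℤ`-order, equal to `O` by maximality
  have hTfg : T.FG := by
    have hMfg := fg_dualSubmodule_of_isFullLattice (nondegenerate_mul_compr₂_reducedTrace hdiv)
      hOZ.isFullLattice
    haveI := isNoetherian_of_fg_of_noetherian _ hMfg
    haveI : IsNoetherian ℤ T := isNoetherian_of_le hTdual
    exact Module.Finite.iff_fg.mp inferInstance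
  have hT : IsZOrder T := ⟨hT1, hTmul, hTfg, fun d => by
    obtain ⟨n, hn, hnd⟩ := hOZ.isFullLattice.2 d
    exact ⟨n, hn, hOT hnd⟩⟩
  have hTO : T = O := hO.2 T hT hOT
  -- a prime-to-`p` multiple of `x` lies in `T = O`
  obtain ⟨n, hn0, hnx⟩ := hOZ.isFullLattice.2 x
  set N : ℕ := n.natAbs with hN
  have hN0 : N ≠ 0 := Int.natAbs_ne_zero.mpr hn0
  have hNx : (N : ℤ) • x ∈ O := by
    rcases Int.natAbs_eq n with h | h
    · rw [hN, ← h]; exact hnx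
    · rw [hN, show (n.natAbs : ℤ) = -n by omega, neg_smul]; exact O.neg_mem hnx
  set a : ℕ := N.factorization p with ha
  set m : ℕ := N / p ^ a with hm
  have hm0 : m ≠ 0 := (Nat.div_pos (Nat.ordProj_le p hN0) (Nat.ordProj_pos N p)).ne'
  have hmcop : m.Coprime p := (Nat.coprime_ordCompl hp.out hN0).symm
  have hpam : p ^ a * m = N := Nat.ordProj_mul_ordCompl_eq_self N p
  have hmx : (m : ℤ) • x ∈ T := by
    refine hTmem.mpr ⟨fun q hq hqp => ?_, not_dvd_den_reducedNorm_zsmul _ hxn,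
      not_dvd_den_reducedTrace_zsmul _ hxt⟩
    have hpq : (p ^ a).Coprime q :=
      Nat.Coprime.pow_left a ((Nat.coprime_primes hp.out hq).mpr (Ne.symm hqp))
    refine mem_localAt_of_smul_mem (pow_ne_zero a hp.out.ne_zero) hpq ?_
    rw [smul_smul, ← Nat.cast_mul, hpam]
    exact hNx
  rw [hTO] at hmx
  exact mem_localAt_of_smul_mem hm0 hmcop hmx

/-- **Maximal orders at a ramified prime** (hypothesis `¬ IsSplitAt B v_p`): for a maximal
`ℤ`-order `O` of `B` and a prime `p = p_v` at which `B` is ramified,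
`x ∈ O_(p) ↔ nrd x ∈ ℤ_(p) ∧ trd x ∈ ℤ_(p)`. [cite: VignerasLNM800, Ch. II §1 Lemme 1.5 and Ch. III §5 Prop. 5.1] -/
theorem IsMaximalZOrder.mem_localAt_iff_of_not_isSplitAt {O : Submodule ℤ B}
    (hO : IsMaximalZOrder O) (v : HeightOneSpectrum (𝓞 ℚ)) (hv : ¬ IsSplitAt B v)
    (hpv : ((Rat.HeightOneSpectrum.primesEquiv v : Nat.Primes) : ℕ) = p) (x : B) :
    x ∈ localAt p O ↔ ¬ p ∣ (reducedNorm ℚ B x).den ∧ ¬ p ∣ (reducedTrace ℚ B x).den :=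
  hO.mem_localAt_iff_of_padic_division
    (forall_isUnit_scalarExtension_padic_of_not_isSplitAt B v hv p hpv) x

/-- **Any two maximal orders agree at a ramified prime**: `O_(p) = O'_(p)` (both are the
valuation ring of `B_p` intersected with `B`; Vignéras II §1 Lemme 1.5, "l'unique ordre
maximal"). [cite: VignerasLNM800, Ch. II §1 Lemme 1.5] -/
theorem IsMaximalZOrder.localAt_eq_of_padic_division {O O' : Submodule ℤ B}
    (hO : IsMaximalZOrder O) (hO' : IsMaximalZOrder O')
    (hdivp : ∀ X : ScalarExtension ℚ ℚ_[p] B, X ≠ 0 → IsUnit X) : localAt p O = localAt p O' := by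
  ext x
  rw [hO.mem_localAt_iff_of_padic_division hdivp, hO'.mem_localAt_iff_of_padic_division hdivp]

/-- Any two maximal orders agree at a ramified prime `p = p_v` (hypothesis `¬ IsSplitAt B v`). [cite: VignerasLNM800, Ch. II §1 Lemme 1.5] -/
theorem IsMaximalZOrder.localAt_eq_of_not_isSplitAt {O O' : Submodule ℤ B}
    (hO : IsMaximalZOrder O) (hO' : IsMaximalZOrder O') (v : HeightOneSpectrum (𝓞 ℚ))
    (hv : ¬ IsSplitAt B v) (hpv : ((Rat.HeightOneSpectrum.primesEquiv v : Nat.Primes) : ℕ) = p) :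
    localAt p O = localAt p O' :=
  hO.localAt_eq_of_padic_division hO'
    (forall_isUnit_scalarExtension_padic_of_not_isSplitAt B v hv p hpv)

/-- **An Eichler order is maximal at the ramified primes**: for maximal orders `O₁, O₂` and a
ramified prime `p`, `(O₁ ∩ O₂)_(p) = O₁,(p)` (localisation commutes with intersections and
`O₁,(p) = O₂,(p)`). This is the level structure of Eichler orders at `p ∣ disc B` (Vignéras II
§2, III §5: "en `p` ramifié un ordre d'Eichler est l'ordre maximal"). [cite: VignerasLNM800, Ch. III §5 (ordres d'Eichler, propriétés locales)] -/
theorem localAt_inf_eq_of_padic_division {O₁ O₂ : Submodule ℤ B} (hO₁ : IsMaximalZOrder O₁)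
    (hO₂ : IsMaximalZOrder O₂) (hdivp : ∀ X : ScalarExtension ℚ ℚ_[p] B, X ≠ 0 → IsUnit X) :
    localAt p (O₁ ⊓ O₂) = localAt p O₁ := by
  rw [localAt_inf, ← hO₁.localAt_eq_of_padic_division hO₂ hdivp, inf_idem]

/-- `(O₁ ∩ O₂)_(p) = O₁,(p)` at a ramified prime `p = p_v` (hypothesis `¬ IsSplitAt B v`). [cite: VignerasLNM800, Ch. III §5 (ordres d'Eichler, propriétés locales)] -/
theorem localAt_inf_eq_of_not_isSplitAt {O₁ O₂ : Submodule ℤ B} (hO₁ : IsMaximalZOrder O₁)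
    (hO₂ : IsMaximalZOrder O₂) (v : HeightOneSpectrum (𝓞 ℚ)) (hv : ¬ IsSplitAt B v)
    (hpv : ((Rat.HeightOneSpectrum.primesEquiv v : Nat.Primes) : ℕ) = p) :
    localAt p (O₁ ⊓ O₂) = localAt p O₁ :=
  localAt_inf_eq_of_padic_division hO₁ hO₂
    (forall_isUnit_scalarExtension_padic_of_not_isSplitAt B v hv p hpv)

/-- The elements of a maximal order with `p`-integral… rather: **at a ramified prime the maximal
order contains every element of `p`-integral norm, locally**: if `nrd x ∈ ℤ_(p)` then
`x ∈ O_(p)` (the trace condition is automatic, Lemme 1.4). [cite: VignerasLNM800, Ch. II §1 Lemme 1.4–1.5] -/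
theorem IsMaximalZOrder.mem_localAt_of_not_dvd_den_reducedNorm {O : Submodule ℤ B}
    (hO : IsMaximalZOrder O) (hdivp : ∀ X : ScalarExtension ℚ ℚ_[p] B, X ≠ 0 → IsUnit X) {x : B}
    (hx : ¬ p ∣ (reducedNorm ℚ B x).den) : x ∈ localAt p O :=
  (hO.mem_localAt_iff_of_padic_division hdivp x).mpr
    ⟨hx, not_dvd_den_reducedTrace_of_not_dvd_den_reducedNorm hdivp hx⟩

end Maximal

end Literature.NumberTheory.Automorphic

end
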